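import Summits.CriticalPhenomena.PercolationContinuityZ3.Theorems.PercNearOneGluingNoHeavyPcintChordMemZ6B10Defs
import HarnessLib

/-!
# PCINT lane, kernel reduced-state B3r certificate `Z6B10` (bond, d = 6, memory τ = 10, 6192 state classes): row checks 5 (rows [2400, 3000))

Cell `prim-pcint`, seat `prim-pcint-2` (gen 4); memo `run/shared/lean/prim/pcint/REDUCTIONS.md` §B3r and HANDOFF ("B3r on reduced states").
Does NOT build on p205010.  Data for `BondK.le_criticalProb_of_checkRowsB` (`…PcintChordMemKernelCert`): `p = 9290/100000`,
`s̄ = 99568/100000` (`s̄²+p² ≥ 1`), refund `r = 100434/100000` (`s̄·r ≥ 1`, `(1-p)·r ≤ 1`), `κ̄ = (100000+99568)/(2·100000)`, `λ = 99999/100000`;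
Collatz–Wielandt weights (scale 10⁹) from a power iteration (ρ ≈ 0.9997074), exact off-line max row ratio 0.9997073741 < λ.
Generated by work/gen/gen_b3r_kernel.py (prim-pcint-2 gen 4 folder; copy in run/shared/lean/prim/pcint/prim-pcint-2/kernel/); the kernel re-checks every row.
-/

namespace Summit.CriticalPhenomena.PercolationContinuityZ3.Theorems.Pcint.ChordMemZ6B10

set_option maxHeartbeats 0 in
/-- Rows `[2400, 2500)` pass the check. [folklore] -/
theorem chk_2400 : WinK.allRange (BondK.checkRowB 10 6 6192 9290 100434 99568 100000 99999 100000 ChordMemZ6B10.syms ChordMemZ6B10.tree) 2400 2500 = true :=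
  WinK.allRange_of_allRangeB (fuel := 8) (lo := 2400) (len := 100) (by decide +kernel)

set_option maxHeartbeats 0 in
/-- Rows `[2500, 2600)` pass the check. [folklore] -/
theorem chk_2500 : WinK.allRange (BondK.checkRowB 10 6 6192 9290 100434 99568 100000 99999 100000 ChordMemZ6B10.syms ChordMemZ6B10.tree) 2500 2600 = true :=
  WinK.allRange_of_allRangeB (fuel := 8) (lo := 2500) (len := 100) (by decide +kernel)

set_option maxHeartbeats 0 in
/-- Rows `[2600, 2700)` pass the check. [folklore] -/
theorem chk_2600 : WinK.allRange (BondK.checkRowB 10 6 6192 9290 100434 99568 100000 99999 100000 ChordMemZ6B10.syms ChordMemZ6B10.tree) 2600 2700 = true :=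
  WinK.allRange_of_allRangeB (fuel := 8) (lo := 2600) (len := 100) (by decide +kernel)

set_option maxHeartbeats 0 in
/-- Rows `[2700, 2800)` pass the check. [folklore] -/
theorem chk_2700 : WinK.allRange (BondK.checkRowB 10 6 6192 9290 100434 99568 100000 99999 100000 ChordMemZ6B10.syms ChordMemZ6B10.tree) 2700 2800 = true :=
  WinK.allRange_of_allRangeB (fuel := 8) (lo := 2700) (len := 100) (by decide +kernel)

set_option maxHeartbeats 0 in
/-- Rows `[2800, 2900)` pass the check. [folklore] -/
theorem chk_2800 : WinK.allRange (BondK.checkRowB 10 6 6192 9290 100434 99568 100000 99999 100000 ChordMemZ6B10.syms ChordMemZ6B10.tree) 2800 2900 = true :=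
  WinK.allRange_of_allRangeB (fuel := 8) (lo := 2800) (len := 100) (by decide +kernel)

set_option maxHeartbeats 0 in
/-- Rows `[2900, 3000)` pass the check. [folklore] -/
theorem chk_2900 : WinK.allRange (BondK.checkRowB 10 6 6192 9290 100434 99568 100000 99999 100000 ChordMemZ6B10.syms ChordMemZ6B10.tree) 2900 3000 = true :=
  WinK.allRange_of_allRangeB (fuel := 8) (lo := 2900) (len := 100) (by decide +kernel)

/-- Rows `[2400, 3000)` pass the check. [folklore] -/
theorem file_5 : WinK.allRange (BondK.checkRowB 10 6 6192 9290 100434 99568 100000 99999 100000 ChordMemZ6B10.syms ChordMemZ6B10.tree) 2400 3000 = true := (WinK.allRange_split (WinK.allRange_split (WinK.allRange_split (WinK.allRange_split (WinK.allRange_split chk_2400 chk_2500) chk_2600) chk_2700) chk_2800) chk_2900)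

end Summit.CriticalPhenomena.PercolationContinuityZ3.Theorems.Pcint.ChordMemZ6B10
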